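import Summits.BirchSwinnertonDyer.Rank1Residual.P2.CongruentNumberHalvingBitsTwoDescent
import HarnessLib

/-!
# Sub-lane «bsd-p2»: the HALVING CHAIN — the halving-bits door (p350663, uniform in `k`) read on ONE
# displayed `(k−2)`-fold half `R` of `s`: `BSD(E_n, 2) ⟺ δ(R) ∉ δ(E_n[2])` GIVEN `T_even`
# (pure `2`-descent bookkeeping over `ℚ` from tree theorems; 0 def; 0 facts; 0 (K); no pair, no numeral
# of a census cell; the `k = 4` reading is the `b₂ ∧ ¬ b₃` certificate shape of the lane's PT17A chain)

HONEST FRAMING (sub-lane «bsd-p2», run/shared/lean/b2b/bsd-rank1-residual/p2/, verbatim in every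
file): the target of record is the FULL Birch–Swinnerton-Dyer formula for EVERY analytic-rank `≤ 1`
`E/ℚ` at ALL primes INCLUDING `2`; the odd-prime class ledger is referee A's; the `2`-part is OPEN
(cells O1 = X5 ∖ CM and O12 = the CM corner) and under census by «bsd-p2». Census / instrument
output at `2` = EVIDENCE / conjecture items with held-out validation, NEVER a Literature fact;
certificates close PAIRS (one isogeny class, `p = 2`), never classes. THIS FILE is unconditional
group-theoretic / `2`-descent bookkeeping on `E_n(ℚ)` from tree theorems (p350663 §1/§3, p352033
§1–§3: `Affine.Point.ker_twoDescentMap` = Silverman AEC Prop. X.1.4 PROVED in the tree; Knapp 4.20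
`E_n(ℚ)_tors = E_n[2]` via `two_nsmul_eq_zero_of_mem_torsion_congruentNumberCurve`). It closes NO pair,
states no conjecture, adds no fact, displays no hypothesis of its own, touches no (K) / mark / tier.
A per-pair certificate assembled through §2 below would still be «`BSD₂(E_n)` modulo `T_even`
(`hT`, PRINTED-ASSERTED: LEMMA (I)-even ∘ Tian–Yuan–Zhang 2017 Thm 3.3, displayed per pair, never
discharged in the tree), `hGZK`, `hMe`» — never unconditional. `hT` is untouched here.

THE POINT OF THIS FILE. The door `rankOne_sha_bsdp_two_iff_halvingBits_congruentNumberCurve_two_mul_prod`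
(p350663 §3) reads, GIVEN `hT : L′(E_n, 1) = 4·Ω·ĥ(s)`: `BSD(E_n, 2) ⟺ b_{k−2}(s) ∧ ¬ b_{k−1}(s)` with
`b_j(s) := ∃ T R, 2 • T = O ∧ s + T = 2^j • R`. A per-pair certificate EXHIBITS halves; this file
shows that exhibiting them is ALL it has to do, UNIFORMLY IN `k` (one theorem with binder `k`, never
one per `k` — p2-lead GEN 8 T-149 rail (a)):
* §1 (the LADDER, binder `j`): if `2^j • R = s + T₀` with `2 • T₀ = O` (a `j`-fold half of `s` modulo
  `E_n[2]`, obtained per pair from the displayed doublings `2 • R₀ = s + T₀`, `2 • R_{i+1} = R_i + T_{i+1}`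
  through the bookkeeping lemma `pow_nsmul_eq_of_two_nsmul_eq`), then `b_j(s)` holds outright and
  `b_{j+1}(s) ⟺ b₁(R) ⟺ δ(R) ∈ δ(E_n[2])` (the halves of `s` at level `j` are `R + E_n(ℚ)_tors =
  R + E_n[2]`, Knapp 4.20; `ker δ = 2E_n(ℚ)`, Silverman X.1.4) — p352033's
  `halvingBit_two_iff_twoDescentMap` is `j = 1`;
* §2 (the DOOR IN CHAIN FORM, binder `k ≥ 2`): GIVEN `hT` and ONE displayed `R` with
  `2^{k−2} • R = s + T₀`: `ord_{s=1} L = 1 ∧ rank 1 ∧ Ш[2^∞] = 0 ∧ (BSD(E_n, 2) ⟺ ∀ T ∈ E_n[2],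
  δ(R) ≠ δ(T))` — FOUR square-class inequalities on the coordinates of `R` (p352033 §2), nothing else;
  the `b₁`-by-two-square-roots witness of the (ε′) kit is then dispensable (the chain IS `b_{k−2}`);
  the `⟸` direction is the certificate, the `⟹` direction says what a MISS looks like in the kernel
  (one more half of `R` modulo torsion gives `¬ BSD(E_n, 2)` UNDER the same displayed binders —
  evidence against `T_even(n)` or an implementation, never a finding by itself).
READINGS (docstring only; nothing per `k` is declared): `k = 3` (even `ℓ = 3`, PT16A/B): `R = R₀`,
`2 • R₀ = s + T₀`, and the theorem is the iff form of p352033 §4 without its `T₁ / hδ₁` inputs; `k = 4`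
(even `ℓ = 4`, the lane's PT17A pre-draft): `R = R₁` with `2 • R₀ = s + T₀`, `2 • R₁ = R₀ + T₁`, so
`2² • R₁ = s + T₀` by `pow_nsmul_eq_of_two_nsmul_eq s R₀ R₁ T₀ T₁ 0`, and `BSD(E_n, 2) ⟺ δ(R₁) ∉ δ(E_n[2])`
is the `b₂ ∧ ¬ b₃` certificate shape (p2-lead GEN 8 `PR-P2-7-CHARTER-PREDRAFT-GEN8.md` §2: «b₂ ∧ ¬b₃ at
k = 4 needs the same recipe applied to the displayed half-point»). NO `ℓ = 4` cell, point or numeral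
appears here or was computed for this file (PT17A's blind regime is untouched).
Statements carry an arbitrary `DecidableEq ℚ` instance (`[inst : DecidableEq ℚ]`, tree idiom of
p352033), so that they apply verbatim to points written with numerals. Cell `openO12` (CM, `2`
ramified); per-pair statements close no class. Nothing booked; no mark moved. Unit
`b2b-bsdres-p2-typer` GEN 18 — SCRATCH (zero-proposal desk prep for the lane's SWEEP 2026-08-24;
p2-lead GEN 8 BATCH 46 (c): nothing proposed before the SWEEP word). Coordinates: p350663 (the door),
p352033 (descent lemmas), p347324 (even door over census vocabulary), the (ε′) kit scratch
`CongruentNumberSquareClassHelpers.scratch.lean` @1631de2bbe55b79f (ruled name `P2/CongruentNumberHalvingBitsPairKit.lean`).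

References: [SilvermanAEC2009] Prop. X.1.4, Thm. VIII.9.3; [Knapp1993] Lemma 4.20;
[Monsky1990MockHeegner] Remark (3) (p. 67); [Miller2011LMS] Def. 1.1; HOME `p2/STRUCTURE-p2.md` §3/§7;
`p2/lead/PR-P2-7-CHARTER-PREDRAFT-GEN8.md` §0–§2; `p2/LEAD-OKS.md` § GEN 7 BATCH 42, § GEN 8 BATCH 45–48.
-/

noncomputable section

open WeierstrassCurve WeierstrassCurve.Affine WeierstrassCurve.Affine.Point
  Literature.NumberTheory.EllipticCurves Literature.NumberTheory.EllipticCurves.TwoDescentLocal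
  Literature.NumberTheory.EllipticCurves.Rank1Residual
  Literature.NumberTheory.EllipticCurves.Rank1Residual.Typed
  Literature.NumberTheory.EllipticCurves.HeathBrown1994

set_option autoImplicit false

namespace Summit.BirchSwinnertonDyer.Rank1Residual.P2

/-! ## §1 The ladder: a `j`-fold half `R` of `s` (`2^j • R = s + T₀`) carries every higher bit of `s` -/

section Ladder

variable [inst : DecidableEq ℚ] {n : ℕ}

/-- **Chain bookkeeping.** One more coordinate doubling extends a half: if `2^{j+1} • R = s + T₀` and
`2 • R' = R + T'` with `2 • T' = O`, then `2^{j+2} • R' = s + T₀` (`2^{j+1} • T' = O`). Per pair this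
turns the displayed doublings `2 • R₀ = s + T₀`, `2 • R₁ = R₀ + T₁`, … into `2^{k−2} • R_{k−3} = s + T₀`.
[folklore] -/
theorem pow_nsmul_eq_of_two_nsmul_eq (s R R' T₀ T' : (congruentNumberCurve n).toAffine.Point) (j : ℕ)
    (hR : (2 ^ (j + 1) : ℕ) • R = s + T₀) (hT' : (2 : ℕ) • T' = 0) (hR' : (2 : ℕ) • R' = R + T') :
    (2 ^ (j + 2) : ℕ) • R' = s + T₀ := by
  have h1 : (2 ^ (j + 2) : ℕ) • R' = (2 ^ (j + 1) : ℕ) • ((2 : ℕ) • R') := by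
    rw [← mul_nsmul', ← pow_succ]
  have h2 : (2 ^ (j + 1) : ℕ) • T' = 0 := by
    rw [pow_succ, mul_nsmul', hT', nsmul_zero]
  rw [h1, hR', nsmul_add, hR, h2, add_zero]

/-- **A displayed `j`-fold half IS the bit `b_j`**: `2^j • R = s + T₀`, `2 • T₀ = O` ⟹
`∃ T R', 2 • T = O ∧ s + T = 2^j • R'`. [folklore] -/
theorem halvingBit_of_pow_nsmul_eq (s R T₀ : (congruentNumberCurve n).toAffine.Point) (j : ℕ)
    (hT₀ : (2 : ℕ) • T₀ = 0) (hR : (2 ^ j : ℕ) • R = s + T₀) :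
    ∃ T R' : (congruentNumberCurve n).toAffine.Point, (2 : ℕ) • T = 0 ∧ s + T = (2 ^ j : ℕ) • R' :=
  ⟨T₀, R, hT₀, hR.symm⟩

/-- **THE LADDER.** On `E_n` (`n` square-free, so `E_n(ℚ)_tors = E_n[2]`, Knapp 4.20): if
`2^j • R = s + T₀` with `2 • T₀ = O`, then `b_{j+1}(s) ⟺ b₁(R)`:
`(∃ T R', 2 • T = O ∧ s + T = 2^{j+1} • R') ⟺ (∃ T R', 2 • T = O ∧ R + T = 2 • R')`.
(`⟹`: `Q := 2 • R' − R` has `2^j • Q = T − T₀`, so `2^{j+1} • Q = O`, `Q` is torsion, `2 • Q = O`, and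
`R + Q = 2 • R'`; `⟸`: `s + (T₀ + 2^j • T) = 2^j • (R + T) = 2^{j+1} • R'`.) p352033's
`halvingBit_two_iff_twoDescentMap` is the case `j = 1`. [cite: Knapp1993, Lemma 4.20]
[cite: SilvermanAEC2009, Thm. VIII.9.3] -/
theorem halvingBit_succ_iff_of_pow_nsmul_eq (hsq : Squarefree n)
    (s R T₀ : (congruentNumberCurve n).toAffine.Point) (j : ℕ) (hT₀ : (2 : ℕ) • T₀ = 0)
    (hR : (2 ^ j : ℕ) • R = s + T₀) :
    (∃ T R' : (congruentNumberCurve n).toAffine.Point, (2 : ℕ) • T = 0 ∧ s + T = (2 ^ (j + 1) : ℕ) • R') ↔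
      ∃ T R' : (congruentNumberCurve n).toAffine.Point, (2 : ℕ) • T = 0 ∧ R + T = (2 : ℕ) • R' := by
  have hpow : ∀ P : (congruentNumberCurve n).toAffine.Point,
      (2 ^ (j + 1) : ℕ) • P = (2 ^ j : ℕ) • ((2 : ℕ) • P) := fun P => by
    rw [← mul_nsmul', ← pow_succ]
  constructor
  · rintro ⟨T, R', hT, hR'⟩
    -- `Q := 2 • R' − R`: `2^j • Q = T − T₀`, hence `2^{j+1} • Q = 0`, `Q` torsion, `2 • Q = 0`
    have hjQ : (2 ^ j : ℕ) • ((2 : ℕ) • R' - R) = T - T₀ := by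
      rw [nsmul_sub, ← hpow, ← hR', hR]; abel
    have hQ0 : (2 ^ (j + 1) : ℕ) • ((2 : ℕ) • R' - R) = 0 := by
      rw [pow_succ, mul_nsmul, hjQ, nsmul_sub, hT, hT₀, sub_zero]
    have hQ : (2 : ℕ) • ((2 : ℕ) • R' - R) = 0 :=
      two_nsmul_eq_zero_of_mem_torsion_congruentNumberCurve hsq _
        ((AddCommGroup.mem_torsion _).mpr
          (isOfFinAddOrder_iff_nsmul_eq_zero.mpr ⟨2 ^ (j + 1), by positivity, hQ0⟩))
    exact ⟨(2 : ℕ) • R' - R, R', hQ, by abel⟩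
  · rintro ⟨T, R', hT, hR'⟩
    refine ⟨T₀ + (2 ^ j : ℕ) • T, R', ?_, ?_⟩
    · rw [nsmul_add, hT₀, zero_add, ← mul_nsmul, mul_comm, mul_nsmul, hT, nsmul_zero]
    · rw [hpow, ← hR', nsmul_add, hR]; abel

/-- **The ladder on the descent map.** With `2^j • R = s + T₀` (`2 • T₀ = O`, `n` square-free):
`b_{j+1}(s) ⟺ ∃ T, 2 • T = O ∧ δ R = δ T` — the `(j+1)`-st halving bit of `s` is decided by the square
classes `(x(R) + n, x(R))` of the displayed half against the four classes `δ(E_n[2])` (p352033 §2).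
[cite: SilvermanAEC2009, Prop. X.1.4] [cite: Knapp1993, Lemma 4.20] -/
theorem halvingBit_succ_iff_twoDescentMap_of_pow_nsmul_eq (hsq : Squarefree n)
    (s R T₀ : (congruentNumberCurve n).toAffine.Point) (j : ℕ) (hT₀ : (2 : ℕ) • T₀ = 0)
    (hR : (2 ^ j : ℕ) • R = s + T₀) :
    haveI := isElliptic_congruentNumberCurve hsq.ne_zero
    (∃ T R' : (congruentNumberCurve n).toAffine.Point, (2 : ℕ) • T = 0 ∧ s + T = (2 ^ (j + 1) : ℕ) • R') ↔
      ∃ T : (congruentNumberCurve n).toAffine.Point, (2 : ℕ) • T = 0 ∧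
        twoDescentMap (splitTwoTorsion_cn n) R = twoDescentMap (splitTwoTorsion_cn n) T := by
  rw [halvingBit_succ_iff_of_pow_nsmul_eq hsq s R T₀ j hT₀ hR, halvingBit_one_iff_twoDescentMap hsq.ne_zero R]

/-- **`¬ b_{j+1}` from four character evaluations on the last half.** With `2^j • R = s + T₀` as
above: if `δ R ≠ δ T` for every `T` with `2 • T = O` (four explicit square-class inequalities,
p352033 §2), then `s ∉ 2^{j+1} E_n(ℚ) + E_n[2]`. [cite: SilvermanAEC2009, Prop. X.1.4]
[cite: Knapp1993, Lemma 4.20] -/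
theorem not_halvingBit_succ_of_twoDescentMap_ne (hsq : Squarefree n)
    (s R T₀ : (congruentNumberCurve n).toAffine.Point) (j : ℕ) (hT₀ : (2 : ℕ) • T₀ = 0)
    (hR : (2 ^ j : ℕ) • R = s + T₀)
    (h : haveI := isElliptic_congruentNumberCurve hsq.ne_zero
      ∀ T : (congruentNumberCurve n).toAffine.Point, (2 : ℕ) • T = 0 →
        twoDescentMap (splitTwoTorsion_cn n) R ≠ twoDescentMap (splitTwoTorsion_cn n) T) :
    ¬ ∃ T R' : (congruentNumberCurve n).toAffine.Point,
      (2 : ℕ) • T = 0 ∧ s + T = (2 ^ (j + 1) : ℕ) • R' := by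
  rw [halvingBit_succ_iff_twoDescentMap_of_pow_nsmul_eq hsq s R T₀ j hT₀ hR]
  rintro ⟨T, hT, he⟩
  exact h T hT he

end Ladder

/-! ## §2 The door in chain form, uniform in `k ≥ 2`: `BSD(E_n, 2) ⟺ δ(R) ∉ δ(E_n[2])` for ONE
displayed `(k−2)`-fold half `R` of `s`, GIVEN `T_even` -/

section Door

variable [inst : DecidableEq ℚ] {k : ℕ} (p : Fin k → ℕ)

/-- **THE HALVING-BITS DOOR IN CHAIN FORM, uniform in `k ≥ 2` (binders `hMe`, `hGZK`; per pair `hT`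
DISPLAYED).** For distinct primes `p₁, …, p_k` with `n = 2p₁⋯p_k ≡ 6 (mod 8)` and `s(n) = 1`, an
explicit `s ∈ E_n(ℚ)` with `2 • s ≠ O`, the hypothesis `T_even : L′(E_n, 1) = 4·Ω·ĥ(s)`, and ONE
displayed point `R` with `2^{k−2} • R = s + T₀` (`2 • T₀ = O`; per pair: `k − 2` coordinate doublings):
`ord_{s=1} L = 1`, rank `1`, `Ш[2^∞] = 0`, and
`BSD(E_n, 2) ⟺ ∀ T, 2 • T = O → δ(R) ≠ δ(T)` — i.e. iff the square classes `(x(R) + n, x(R))` avoid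
`{(1, 1), (2n², −n), (n, −n²), (2n, n)}` (p352033 §2: four quadratic-character evaluations). The chain is
the bit `b_{k−2}(s)`; the last half decides `b_{k−1}(s)` (§1). Monsky's exponent law (1990, p. 67
Remark (3): «divisible by `2^{ℓ−2}`, but not by `2^{ℓ−1}`») in E-side currency, read on one point.
CONDITIONAL on `hT` (PRINTED-ASSERTED, never discharged in the tree); closes no class (cell `openO12`).
[cite: Monsky1990MockHeegner, Remark (3) (p. 67)] [cite: SilvermanAEC2009, Prop. X.1.4]
[cite: Miller2011LMS, Def. 1.1 (arXiv:1010.2431 p. 3)] -/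
theorem rankOne_sha_bsdp_two_iff_twoDescentMap_ne_of_pow_nsmul_eq_congruentNumberCurve_two_mul_prod
    (hGZK : rank_eq_analyticRank_of_analyticRank_le_one) (hMe : monsky_card_selmerGroup_two_even)
    (hk : 2 ≤ k) (hp : ∀ i, (p i).Prime) (hinj : Function.Injective p) {n : ℕ} (hn : 2 * ∏ i, p i = n)
    (h8 : n % 8 = 6) (hs : monskySelmerRankEven p = 1) (hn0 : n ≠ 0)
    (s : (congruentNumberCurve n).toAffine.Point) (hs2 : (2 : ℕ) • s ≠ 0)
    (hT : deriv (congruentNumberCurve n).entireLFunction 1 =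
      (4 : ℂ) * ((congruentNumberCurve n).realPeriodRat : ℂ) * (s.canonicalHeight : ℂ))
    (R T₀ : (congruentNumberCurve n).toAffine.Point) (hT₀ : (2 : ℕ) • T₀ = 0)
    (hR : (2 ^ (k - 2) : ℕ) • R = s + T₀) :
    (congruentNumberCurve n).analyticRank = 1 ∧ (congruentNumberCurve n).mordellWeilRank = 1 ∧
      AddCommGroup.primaryComponent (congruentNumberCurve n).sha 2 = ⊥ ∧
      (BSDp (congruentNumberCurve n) 2 ↔
        haveI := isElliptic_congruentNumberCurve hn0
        ∀ T : (congruentNumberCurve n).toAffine.Point, (2 : ℕ) • T = 0 →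
          twoDescentMap (splitTwoTorsion_cn n) R ≠ twoDescentMap (splitTwoTorsion_cn n) T) := by
  have hsq : Squarefree n :=
    hn ▸ squarefree_two_mul_prod_of_injective p hp (odd_of_two_mul_prod_mod_eight_six p hn h8) hinj
  obtain ⟨hr1, hrank, hbot, hiff⟩ :=
    rankOne_sha_bsdp_two_iff_halvingBits_congruentNumberCurve_two_mul_prod p hGZK hMe hk hp hinj hn h8
      hs s hs2 hT
  refine ⟨hr1, hrank, hbot, ?_⟩
  rw [hiff, show k - 1 = k - 2 + 1 from by omega,
    halvingBit_succ_iff_twoDescentMap_of_pow_nsmul_eq hsq s R T₀ (k - 2) hT₀ hR]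
  constructor
  · rintro ⟨-, hnot⟩ T hT he
    exact hnot ⟨T, hT, he⟩
  · intro h
    exact ⟨halvingBit_of_pow_nsmul_eq s R T₀ (k - 2) hT₀ hR, fun ⟨T, hT, he⟩ => h T hT he⟩

/-- **ASSEMBLY, uniform in `k ≥ 2` (modulo `hGZK`, `hMe` and the DISPLAYED `hT`).** The `⟸` half of
the chain-form door: cell data, `s` with `2 • s ≠ O`, `hT`, one `(k−2)`-fold half `R` of `s` modulo
`E_n[2]`, and `δ(R) ∉ δ(E_n[2])` give `ord_{s=1} L(E_n, s) = 1 ∧ rank 1 ∧ Ш(E_n)[2^∞] = 0 ∧ BSD(E_n, 2)`.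
A pair closed this way is «`BSD₂(E_n)` modulo `T_even(n)`, GZK, Monsky's even matrix theorem»,
nothing more. [cite: Monsky1990MockHeegner, Remark (3) (p. 67)] [cite: SilvermanAEC2009, Prop. X.1.4]
[cite: Miller2011LMS, Def. 1.1 (arXiv:1010.2431 p. 3)] -/
theorem rankOne_sha_bsdp_two_of_pow_nsmul_eq_congruentNumberCurve_two_mul_prod
    (hGZK : rank_eq_analyticRank_of_analyticRank_le_one) (hMe : monsky_card_selmerGroup_two_even)
    (hk : 2 ≤ k) (hp : ∀ i, (p i).Prime) (hinj : Function.Injective p) {n : ℕ} (hn : 2 * ∏ i, p i = n)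
    (h8 : n % 8 = 6) (hs : monskySelmerRankEven p = 1) (hn0 : n ≠ 0)
    (s : (congruentNumberCurve n).toAffine.Point) (hs2 : (2 : ℕ) • s ≠ 0)
    (hT : deriv (congruentNumberCurve n).entireLFunction 1 =
      (4 : ℂ) * ((congruentNumberCurve n).realPeriodRat : ℂ) * (s.canonicalHeight : ℂ))
    (R T₀ : (congruentNumberCurve n).toAffine.Point) (hT₀ : (2 : ℕ) • T₀ = 0)
    (hR : (2 ^ (k - 2) : ℕ) • R = s + T₀)
    (hδ : haveI := isElliptic_congruentNumberCurve hn0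
      ∀ T : (congruentNumberCurve n).toAffine.Point, (2 : ℕ) • T = 0 →
        twoDescentMap (splitTwoTorsion_cn n) R ≠ twoDescentMap (splitTwoTorsion_cn n) T) :
    (congruentNumberCurve n).analyticRank = 1 ∧ (congruentNumberCurve n).mordellWeilRank = 1 ∧
      AddCommGroup.primaryComponent (congruentNumberCurve n).sha 2 = ⊥ ∧
      BSDp (congruentNumberCurve n) 2 := by
  obtain ⟨hr1, hrank, hbot, hiff⟩ :=
    rankOne_sha_bsdp_two_iff_twoDescentMap_ne_of_pow_nsmul_eq_congruentNumberCurve_two_mul_prod p hGZK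
      hMe hk hp hinj hn h8 hs hn0 s hs2 hT R T₀ hT₀ hR
  exact ⟨hr1, hrank, hbot, hiff.mpr hδ⟩

end Door

end Summit.BirchSwinnertonDyer.Rank1Residual.P2

end
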